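import Summits.RiemannHypothesis.RiemannHypothesis.Theorems.HandoffDodgerSmallPhi
import HarnessLib

/-!
# HANDOFF — THIRD SLAB (5): the profile value at `y = 38` for the SHARP witness (rh-explicit, D-0040 WEIL column prover seat handoff-prove-2 gen13, ATTEMPT-23)

RH-FREE. HONEST FRAMING: nothing here bears on the truth of RH; part (5) of the discharge of the hypotheses of
`HandoffDodgerExplicit.dodger_witness_explicit` on the third slab `12500 ≤ q < 25000` at the constant schedule `y = 38`, for the SHARP witness
`dodger_witness_explicit_sharp` whose profile argument is the CONSTANT `x = 3249y²/6400 = 733.06`, so ONE partial sum suffices —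
`Φ(733.06) ≥ Σ_{n ≤ 8} 733.06ⁿ/(n!(2n)!) ≥ 1.69·10⁶`, whence **`1330000·(b+1.84)·e^{2b} < Φ²`** for `b ≤ 5.07`,
`e^{2b} ≤ 25000` (left side `≤ 2.3·10¹¹ < 2.85·10¹²`).

References: this track (ATTEMPT-16 §1, ATTEMPT-21 §6, ATTEMPT-23 §7).
-/

set_option linter.dupNamespace false

noncomputable section

open Real Finset

namespace Summit.RiemannHypothesis.RiemannHypothesis.Theorems.Handoff

/-- `Σ_{n ≤ 8} xⁿ/(n!(2n)!) ≥ 1.69·10⁶` at `x = 733.06 = 3249·38²/6400`. [this track, ATTEMPT-23 §7] -/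
theorem profileSum_ge_slabThree :
    (1690000 : ℝ) ≤ ∑ n ∈ range 9, ((1172889 : ℝ) / 1600) ^ n / ((n.factorial : ℝ) * ((2 * n).factorial : ℝ)) := by
  simp only [sum_range_succ, sum_range_zero, Nat.factorial]
  norm_num

/-- **Part (5) of the third-slab discharge: the profile value at `y = 38` (sharp argument).** For `4.715 ≤ b ≤ 5.07`, `e^{2b} ≤ 25000` and
`Φ = Σ_m (3249y²/6400)^m/(m!(2m)!)` with `y = 38`: **`1330000·(b+1.84)·e^{2b} < Φ²`**. [this track, ATTEMPT-23 §7] -/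
theorem profile_value_slabThree {b y Φ : ℝ} (hb0 : 943 / 200 ≤ b) (hb1 : b ≤ 507 / 100) (he' : Real.exp (2 * b) ≤ 25000)
    (hy : y = 38)
    (hΦ : HasSum (fun m : ℕ => (3249 * y ^ 2 / 6400) ^ m / ((m.factorial : ℝ) * ((2 * m).factorial : ℝ))) Φ) :
    1330000 * (b + 1.84) * Real.exp (2 * b) < Φ ^ 2 := by
  have hx : 3249 * y ^ 2 / 6400 = (1172889 : ℝ) / 1600 := by rw [hy]; norm_num
  rw [hx] at hΦ
  have hS := profileSum_le_of_hasSum (by norm_num : (0 : ℝ) ≤ 1172889 / 1600) hΦ 9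
  have hΦge : (1690000 : ℝ) ≤ Φ := profileSum_ge_slabThree.trans hS
  have hE := Real.exp_pos (2 * b)
  have hb' : 0 ≤ 1330000 * (b + 1.84) := by linarith
  have h1 : 1330000 * (b + 1.84) * Real.exp (2 * b) ≤ 1330000 * (507 / 100 + 1.84) * 25000 :=
    mul_le_mul (by linarith) he' hE.le (by norm_num)
  calc 1330000 * (b + 1.84) * Real.exp (2 * b) ≤ 1330000 * (507 / 100 + 1.84) * 25000 := h1
    _ < 1690000 ^ 2 := by norm_num
    _ ≤ Φ ^ 2 := pow_le_pow_left₀ (by norm_num) hΦge 2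

end Summit.RiemannHypothesis.RiemannHypothesis.Theorems.Handoff

end
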